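import Summits.PneNP.PneNP.Theorems.NegLimitedAmplifiedWindowBaseA
import Literature.Computability.Complexity.CliqueThresholdBounds
import Mathlib
import HarnessLib

/-!
# Amplified critical window — base helper (c): the critical second moment `CriticalSecondMoment`
(cell pnp-ideate, rung F-N1/p3, ROUND-11; line `amplified-window` on item stmt-PneNP-19860, stub B
`CriticalWindowHardness`; typed statement `CriticalSecondMoment` of
`Theorems/NegLimitedAmplifiedWindowBaseDefs.lean` = pnp-ideate-p3 r11/base-helpers.lean, referee-approved
prover target (ref g24 SCORE-R11))

`criticalSecondMoment_holds : CriticalSecondMoment` — for `k ≥ 2`, `b ≥ 1` there is `K₂ = k·2^k·b^{2C(k,2)}`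
such that for `n ≥ 1`, `p ∈ [0,1]`, `p ≤ b·n^{−2/(k−1)}`:

  `E_{G(n,p)}[N_k²] ≤ λ + λ² + K₂/n`,  `λ = C(n,k)·p^{C(k,2)}`.

Proof (Bollobás–Erdős / Rossman 2010 App. B bookkeeping): `E[N_k²] = Σ_A p^{C(k,2)} Σ_B p^{C(k,2) − C(|A∩B|,2)}`
(`sum_gnpWeight_mul_cliqueCount_sq`: planting identity `sum_filter_forall_gnpWeight_mul` and
`gnpProb_forall_cliqueVec_sup`); the diagonal `B = A` gives `λ`; the disjoint pairs (`|A ∩ B| = 0`) give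
`≤ λ²`; for `1 ≤ j = |A∩B| ≤ k−1` there are `≤ 2^k n^{k−j}` sets `B` each contributing
`≤ b^{C(k,2)} n^{−(2/(k−1))(C(k,2) − C(j,2))}`, and `n^{k−j} n^{−(2/(k−1))(C(k,2)−C(j,2))} = n^{−j(k−j)/(k−1)}
≤ n^{−1}` since `j(k−j) − (k−1) = (j−1)(k−1−j) ≥ 0` (`pow_mul_rpow_threshold_le_inv`); finally
`λ ≤ b^{C(k,2)}` (`choose_mul_threshold_pow_le`).

HONEST FRAMING: an elementary second-moment estimate, one input of the OPEN stub B; no hardness is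
proved; FRONTIER rung F-N1 — nothing here bears on P vs NP.
-/

set_option linter.dupNamespace false -- `Summit.PneNP.PneNP.…`: summit = sub-problem name (D-0017 single-conjunct layout)

namespace Summit.PneNP.PneNP.Theorems.NegLimitedDoor.AmplifiedWindowBase

open Finset
open Literature.Computability.Complexity

/-! ### The second moment as a double sum over `k`-sets -/

/-- `Pr[K_A ⊆ G ∧ K_B ⊆ G] = p^{C(|A|,2)} · p^{C(|B|,2) − C(|A∩B|,2)}`. -/
theorem sum_gnpWeight_ind_ind {n : ℕ} (p : ℝ) (A B : Finset (Fin n)) :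
    ∑ x, gnpWeight n p x * ((if (∀ e, cliqueVec A e = true → x e = true) then (1 : ℝ) else 0) *
        (if (∀ e, cliqueVec B e = true → x e = true) then (1 : ℝ) else 0)) =
      p ^ (#A).choose 2 * p ^ ((#B).choose 2 - (#(A ∩ B)).choose 2) := by
  classical
  have h1 : ∑ x, gnpWeight n p x * ((if (∀ e, cliqueVec A e = true → x e = true) then (1 : ℝ) else 0) *
        (if (∀ e, cliqueVec B e = true → x e = true) then (1 : ℝ) else 0)) =
      ∑ x ∈ univ.filter (fun x : (⊤ : SimpleGraph (Fin n)).edgeSet → Bool =>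
          ∀ e, cliqueVec A e = true → x e = true),
        gnpWeight n p x * (if (∀ e, cliqueVec B e = true → x e = true) then (1 : ℝ) else 0) := by
    rw [sum_filter]
    refine sum_congr rfl fun x _ => ?_
    split_ifs <;> ring
  have h2 := sum_filter_forall_gnpWeight_mul p (cliqueVec A)
    (fun x => if (∀ e, cliqueVec B e = true → x e = true) then (1 : ℝ) else 0)
  have h3 : ∑ x, gnpWeight n p x *
      (if (∀ e, cliqueVec B e = true → (x ⊔ cliqueVec A) e = true) then (1 : ℝ) else 0) =
      gnpProb n p (univ.filter fun x : (⊤ : SimpleGraph (Fin n)).edgeSet → Bool =>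
        ∀ e, cliqueVec B e = true → (x ⊔ cliqueVec A) e = true) := by
    rw [gnpProb_filter]
    refine sum_congr rfl fun x _ => ?_
    split_ifs <;> simp
  rw [h1, h2, h3, gnpProb_forall_cliqueVec_sup, edgeCount_cliqueVec]

/-- **`E[N_k²]` as a double sum**: `Σ_x w_p(x) N_k(x)² = Σ_A p^{C(k,2)} Σ_B p^{C(k,2) − C(|A∩B|,2)}`
over the `k`-sets `A, B`. -/
theorem sum_gnpWeight_mul_cliqueCount_sq (n k : ℕ) (p : ℝ) :
    ∑ x, gnpWeight n p x * (cliqueCount n k x : ℝ) ^ 2 =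
      ∑ A ∈ powersetCard k (univ : Finset (Fin n)), p ^ k.choose 2 *
        ∑ B ∈ powersetCard k (univ : Finset (Fin n)), p ^ (k.choose 2 - (#(A ∩ B)).choose 2) := by
  classical
  calc ∑ x, gnpWeight n p x * (cliqueCount n k x : ℝ) ^ 2
      = ∑ x, ∑ A ∈ powersetCard k (univ : Finset (Fin n)), ∑ B ∈ powersetCard k (univ : Finset (Fin n)),
          gnpWeight n p x * ((if (∀ e, cliqueVec A e = true → x e = true) then (1 : ℝ) else 0) *
            (if (∀ e, cliqueVec B e = true → x e = true) then (1 : ℝ) else 0)) := by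
        refine sum_congr rfl fun x _ => ?_
        rw [cliqueCount_eq_sum, sq, sum_mul_sum, mul_sum]
        refine sum_congr rfl fun A _ => ?_
        rw [mul_sum]
    _ = ∑ A ∈ powersetCard k (univ : Finset (Fin n)), ∑ B ∈ powersetCard k (univ : Finset (Fin n)),
          ∑ x, gnpWeight n p x * ((if (∀ e, cliqueVec A e = true → x e = true) then (1 : ℝ) else 0) *
            (if (∀ e, cliqueVec B e = true → x e = true) then (1 : ℝ) else 0)) := by
        rw [sum_comm]
        refine sum_congr rfl fun A _ => ?_
        rw [sum_comm]
    _ = ∑ A ∈ powersetCard k (univ : Finset (Fin n)), p ^ k.choose 2 *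
          ∑ B ∈ powersetCard k (univ : Finset (Fin n)), p ^ (k.choose 2 - (#(A ∩ B)).choose 2) := by
        refine sum_congr rfl fun A hA => ?_
        rw [mul_sum]
        refine sum_congr rfl fun B hB => ?_
        rw [sum_gnpWeight_ind_ind, (mem_powersetCard.1 hA).2, (mem_powersetCard.1 hB).2]

/-! ### The overlap sum at the threshold, critical form -/

/-- Sharper threshold arithmetic: for `1 ≤ j < k` and `n ≥ 1`,
`n^{k−j} · (n^{−2/(k−1)})^{C(k,2) − C(j,2)} ≤ n^{−1}` (the exponent is `−j(k−j)/(k−1) ≤ −1` because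
`j(k−j) − (k−1) = (j−1)(k−1−j) ≥ 0`). -/
theorem pow_mul_rpow_threshold_le_inv {n k j : ℕ} (hj1 : 1 ≤ j) (hjk : j < k) (hn : 1 ≤ n) :
    (n : ℝ) ^ (k - j) * ((n : ℝ) ^ (-(2 : ℝ) / ((k : ℝ) - 1))) ^ (k.choose 2 - j.choose 2) ≤ (n : ℝ)⁻¹ := by
  have hn0 : (0 : ℝ) < n := by exact_mod_cast hn
  have hn1 : (1 : ℝ) ≤ n := by exact_mod_cast hn
  have hk1 : (0 : ℝ) < (k : ℝ) - 1 := by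
    have : (j : ℝ) + 1 ≤ k := by exact_mod_cast hjk
    have : (1 : ℝ) ≤ j := by exact_mod_cast hj1
    linarith
  have hjk' : j ≤ k := hjk.le
  have hchoose : j.choose 2 ≤ k.choose 2 := Nat.choose_le_choose 2 hjk'
  rw [← Real.rpow_natCast, ← Real.rpow_mul_natCast hn0.le, ← Real.rpow_add hn0, ← Real.rpow_neg_one]
  refine Real.rpow_le_rpow_of_exponent_le hn1 ?_
  rw [Nat.cast_sub hjk', Nat.cast_sub hchoose, Nat.cast_choose_two, Nat.cast_choose_two]
  have hj' : (j : ℝ) ≤ k - 1 := by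
    have : (j : ℝ) + 1 ≤ k := by exact_mod_cast hjk
    linarith
  have hj1' : (1 : ℝ) ≤ j := by exact_mod_cast hj1
  rw [div_mul_eq_mul_div, ← sub_nonneg]
  have key : 0 ≤ ((j : ℝ) - 1) * ((k : ℝ) - 1 - j) := mul_nonneg (by linarith) (by linarith)
  rw [show (-1 : ℝ) - (((k : ℝ) - j) + -2 * ((k : ℝ) * ((k : ℝ) - 1) / 2 - (j : ℝ) * ((j : ℝ) - 1) / 2) /
      ((k : ℝ) - 1)) = ((j : ℝ) - 1) * ((k : ℝ) - 1 - j) / ((k : ℝ) - 1) by field_simp; ring]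
  positivity

/-- **The overlap sum is critical at the threshold.**  For a `k`-set `A` (`k ≥ 2`), `n ≥ 1` and
`0 ≤ p ≤ b·n^{−2/(k−1)}` with `b ≥ 1`:
`Σ_{B ≠ A} p^{C(k,2) − C(|A∩B|,2)} ≤ C(n,k) p^{C(k,2)} + k·2^k·b^{C(k,2)}/n`
(disjoint `B` contribute `≤ λ`; overlapping `B ≠ A` contribute `O(1/n)`). -/
theorem sum_erase_pow_inter_le_critical {n k : ℕ} (hk : 2 ≤ k) (hn : 1 ≤ n) {p b : ℝ} (hp0 : 0 ≤ p)
    (hb : 1 ≤ b) (hpb : p ≤ b * (n : ℝ) ^ (-(2 : ℝ) / ((k : ℝ) - 1)))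
    {A : Finset (Fin n)} (hA : A ∈ powersetCard k (univ : Finset (Fin n))) :
    ∑ B ∈ (powersetCard k (univ : Finset (Fin n))).erase A, p ^ (k.choose 2 - (#(A ∩ B)).choose 2) ≤
      (n.choose k : ℝ) * p ^ k.choose 2 + k * 2 ^ k * b ^ k.choose 2 / n := by
  classical
  set θ : ℝ := (n : ℝ) ^ (-(2 : ℝ) / ((k : ℝ) - 1)) with hθ
  set 𝒜 := powersetCard k (univ : Finset (Fin n)) with h𝒜
  have hAk : #A = k := (mem_powersetCard.1 hA).2
  have hθ0 : 0 ≤ θ := Real.rpow_nonneg (Nat.cast_nonneg n) _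
  have hb0 : 0 ≤ b := zero_le_one.trans hb
  have hn0 : (0 : ℝ) < n := by exact_mod_cast hn
  -- the overlap of `B ≠ A` with `A` is a proper subset
  have hmaps : ∀ B ∈ 𝒜.erase A, #(A ∩ B) ∈ range k := by
    intro B hB
    obtain ⟨hne, hB𝒜⟩ := mem_erase.1 hB
    have hBk : #B = k := (mem_powersetCard.1 hB𝒜).2
    rw [mem_range, lt_iff_le_and_ne]
    refine ⟨hAk ▸ card_le_card inter_subset_left, fun heq => hne ?_⟩
    have h1 : A ∩ B = A := eq_of_subset_of_card_le inter_subset_left (by rw [heq, hAk])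
    have h2 : A ⊆ B := fun v hv => (mem_inter.1 (h1.symm ▸ hv)).2
    exact (eq_of_subset_of_card_le h2 (by rw [hAk, hBk])).symm
  -- size of the fibres
  have hfib : ∀ j ∈ range k, (#((𝒜.erase A).filter fun B => #(A ∩ B) = j) : ℝ) ≤ 2 ^ k * (n : ℝ) ^ (k - j) := by
    intro j hj
    have hinj : #((𝒜.erase A).filter fun B => #(A ∩ B) = j) ≤
        #(powersetCard j A ×ˢ powersetCard (k - j) Aᶜ) := by
      refine card_le_card_of_injOn (fun B => (A ∩ B, B \ A)) (fun B hB => ?_) (fun B₁ hB₁ B₂ hB₂ h => ?_)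
      · rw [mem_coe, mem_filter, mem_erase] at hB
        obtain ⟨⟨hne, hB𝒜⟩, hj'⟩ := hB
        have hBk : #B = k := (mem_powersetCard.1 hB𝒜).2
        simp only [mem_coe, mem_product, mem_powersetCard]
        refine ⟨⟨inter_subset_left, hj'⟩, fun v hv => mem_compl.2 (Finset.mem_sdiff.1 hv).2, ?_⟩
        have := card_sdiff_add_card_inter B A
        rw [inter_comm, hj', hBk] at this
        omega
      · simp only [Prod.mk.injEq] at h
        obtain ⟨h1, h2⟩ := h
        ext v
        by_cases hv : v ∈ A
        · have := Finset.ext_iff.1 h1 v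
          simp only [mem_inter, hv, true_and] at this
          exact this
        · have := Finset.ext_iff.1 h2 v
          simp only [Finset.mem_sdiff, hv, not_false_eq_true, and_true] at this
          exact this
    rw [card_product, card_powersetCard, card_powersetCard, card_compl, Fintype.card_fin, hAk] at hinj
    have h1 : k.choose j ≤ 2 ^ k := Nat.choose_le_two_pow k j
    have h2 : (n - k).choose (k - j) ≤ n ^ (k - j) :=
      (Nat.choose_le_pow _ _).trans (Nat.pow_le_pow_left (Nat.sub_le n k) _)
    calc (#((𝒜.erase A).filter fun B => #(A ∩ B) = j) : ℝ)
        ≤ ((k.choose j * (n - k).choose (k - j) : ℕ) : ℝ) := by exact_mod_cast hinj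
      _ ≤ ((2 ^ k * n ^ (k - j) : ℕ) : ℝ) := by exact_mod_cast Nat.mul_le_mul h1 h2
      _ = 2 ^ k * (n : ℝ) ^ (k - j) := by push_cast; ring
  -- the disjoint fibre is at most the whole family
  have hfib0 : (#((𝒜.erase A).filter fun B => #(A ∩ B) = 0) : ℝ) ≤ (n.choose k : ℝ) := by
    have h : #((𝒜.erase A).filter fun B => #(A ∩ B) = 0) ≤ #𝒜 :=
      card_le_card ((filter_subset _ _).trans (erase_subset _ _))
    rw [h𝒜, card_powersetCard, card_univ, Fintype.card_fin] at h
    exact_mod_cast h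
  -- size of the terms
  have hterm : ∀ j ∈ range k, p ^ (k.choose 2 - j.choose 2) ≤ b ^ k.choose 2 * θ ^ (k.choose 2 - j.choose 2) := by
    intro j hj
    have hN : k.choose 2 - j.choose 2 ≤ k.choose 2 := Nat.sub_le _ _
    calc p ^ (k.choose 2 - j.choose 2) ≤ (b * θ) ^ (k.choose 2 - j.choose 2) :=
          pow_le_pow_left₀ hp0 hpb _
      _ = b ^ (k.choose 2 - j.choose 2) * θ ^ (k.choose 2 - j.choose 2) := mul_pow _ _ _
      _ ≤ b ^ k.choose 2 * θ ^ (k.choose 2 - j.choose 2) :=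
          mul_le_mul_of_nonneg_right (pow_le_pow_right₀ hb hN) (pow_nonneg hθ0 _)
  -- sum fibrewise
  rw [← sum_fiberwise_of_maps_to hmaps]
  have hinner : ∀ j ∈ range k,
      ∑ B ∈ (𝒜.erase A).filter (fun B => #(A ∩ B) = j), p ^ (k.choose 2 - (#(A ∩ B)).choose 2) ≤
        if j = 0 then (n.choose k : ℝ) * p ^ k.choose 2 else 2 ^ k * b ^ k.choose 2 / n := by
    intro j hj
    have hjk : j < k := mem_range.1 hj
    have hconst : ∑ B ∈ (𝒜.erase A).filter (fun B => #(A ∩ B) = j), p ^ (k.choose 2 - (#(A ∩ B)).choose 2) =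
        #((𝒜.erase A).filter fun B => #(A ∩ B) = j) * p ^ (k.choose 2 - j.choose 2) := by
      rw [sum_congr rfl fun B hB => by rw [(mem_filter.1 hB).2], sum_const, nsmul_eq_mul]
    rw [hconst]
    split_ifs with hj0
    · subst hj0
      rw [Nat.choose_zero_succ, Nat.sub_zero]
      exact mul_le_mul_of_nonneg_right hfib0 (pow_nonneg hp0 _)
    · have hj1 : 1 ≤ j := Nat.one_le_iff_ne_zero.2 hj0
      calc (#((𝒜.erase A).filter fun B => #(A ∩ B) = j) : ℝ) * p ^ (k.choose 2 - j.choose 2)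
          ≤ (2 ^ k * (n : ℝ) ^ (k - j)) * (b ^ k.choose 2 * θ ^ (k.choose 2 - j.choose 2)) :=
            mul_le_mul (hfib j hj) (hterm j hj) (pow_nonneg hp0 _) (by positivity)
        _ = 2 ^ k * b ^ k.choose 2 * ((n : ℝ) ^ (k - j) * θ ^ (k.choose 2 - j.choose 2)) := by ring
        _ ≤ 2 ^ k * b ^ k.choose 2 * (n : ℝ)⁻¹ :=
            mul_le_mul_of_nonneg_left (pow_mul_rpow_threshold_le_inv hj1 hjk hn) (by positivity)
        _ = 2 ^ k * b ^ k.choose 2 / n := by rw [div_eq_mul_inv]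
  calc ∑ j ∈ range k, ∑ B ∈ (𝒜.erase A).filter (fun B => #(A ∩ B) = j),
          p ^ (k.choose 2 - (#(A ∩ B)).choose 2)
      ≤ ∑ j ∈ range k, (if j = 0 then (n.choose k : ℝ) * p ^ k.choose 2 else 2 ^ k * b ^ k.choose 2 / n) :=
        sum_le_sum hinner
    _ ≤ (n.choose k : ℝ) * p ^ k.choose 2 + ∑ j ∈ range k, 2 ^ k * b ^ k.choose 2 / n := by
        have h0 : (0 : ℕ) ∈ range k := mem_range.2 (by omega)
        rw [← add_sum_erase _ _ h0, if_pos rfl]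
        have h1 : ∑ j ∈ (range k).erase 0,
            (if j = 0 then (n.choose k : ℝ) * p ^ k.choose 2 else 2 ^ k * b ^ k.choose 2 / n) ≤
            ∑ j ∈ (range k).erase 0, 2 ^ k * b ^ k.choose 2 / n :=
          sum_le_sum fun j hj => by rw [if_neg (ne_of_mem_erase hj)]
        have h2 : ∑ j ∈ (range k).erase 0, (2 : ℝ) ^ k * b ^ k.choose 2 / n ≤
            ∑ j ∈ range k, 2 ^ k * b ^ k.choose 2 / n :=
          sum_le_sum_of_subset_of_nonneg (erase_subset _ _) fun j _ _ => by positivity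
        linarith
    _ = (n.choose k : ℝ) * p ^ k.choose 2 + k * 2 ^ k * b ^ k.choose 2 / n := by
        rw [sum_const, card_range, nsmul_eq_mul]
        ring

/-! ### The stub's statement -/

/-- **`CriticalSecondMoment` holds** with `K₂ = k·2^k·b^{2C(k,2)}`. -/
theorem criticalSecondMoment_holds : CriticalSecondMoment := by
  classical
  intro k hk b hb
  refine ⟨k * 2 ^ k * b ^ (2 * k.choose 2), by positivity, ?_⟩
  intro n hn p hp0 hp1 hpb
  have hb0 : 0 ≤ b := zero_le_one.trans hb
  have hn0 : (0 : ℝ) < n := by exact_mod_cast hn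
  set lam := (n.choose k : ℝ) * p ^ k.choose 2 with hlam
  have hlam0 : 0 ≤ lam := by positivity
  -- `λ ≤ b^{C(k,2)}`
  have hlamb : lam ≤ b ^ k.choose 2 := by
    calc lam ≤ (n.choose k : ℝ) * (b * (n : ℝ) ^ (-(2 : ℝ) / ((k : ℝ) - 1))) ^ k.choose 2 :=
          mul_le_mul_of_nonneg_left (pow_le_pow_left₀ hp0 hpb _) (Nat.cast_nonneg _)
      _ ≤ b ^ k.choose 2 := choose_mul_threshold_pow_le hk hn hb0
  -- the double sum, diagonal split off
  rw [sum_gnpWeight_mul_cliqueCount_sq]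
  have hA : ∀ A ∈ powersetCard k (univ : Finset (Fin n)),
      p ^ k.choose 2 * ∑ B ∈ powersetCard k (univ : Finset (Fin n)), p ^ (k.choose 2 - (#(A ∩ B)).choose 2) ≤
        p ^ k.choose 2 * (1 + (lam + k * 2 ^ k * b ^ k.choose 2 / n)) := by
    intro A hA
    refine mul_le_mul_of_nonneg_left ?_ (pow_nonneg hp0 _)
    have hAk : #A = k := (mem_powersetCard.1 hA).2
    rw [← add_sum_erase _ _ hA, inter_self, hAk, Nat.sub_self, pow_zero]
    linarith [sum_erase_pow_inter_le_critical hk hn hp0 hb hpb hA]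
  calc ∑ A ∈ powersetCard k (univ : Finset (Fin n)), p ^ k.choose 2 *
          ∑ B ∈ powersetCard k (univ : Finset (Fin n)), p ^ (k.choose 2 - (#(A ∩ B)).choose 2)
      ≤ ∑ A ∈ powersetCard k (univ : Finset (Fin n)),
          p ^ k.choose 2 * (1 + (lam + k * 2 ^ k * b ^ k.choose 2 / n)) := sum_le_sum hA
    _ = lam * (1 + (lam + k * 2 ^ k * b ^ k.choose 2 / n)) := by
        rw [sum_const, card_powersetCard, card_univ, Fintype.card_fin, nsmul_eq_mul, hlam]
        ring
    _ = lam + lam ^ 2 + lam * (k * 2 ^ k * b ^ k.choose 2) / n := by ring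
    _ ≤ lam + lam ^ 2 + b ^ k.choose 2 * (k * 2 ^ k * b ^ k.choose 2) / n := by
        gcongr
    _ = lam + lam ^ 2 + k * 2 ^ k * b ^ (2 * k.choose 2) / n := by
        rw [two_mul, pow_add]
        ring

end Summit.PneNP.PneNP.Theorems.NegLimitedDoor.AmplifiedWindowBase
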